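import Summits.BirchSwinnertonDyer.Rank1Residual.X2.GreenbergVatsalCaseTwoPeriodFree
import Summits.BirchSwinnertonDyer.Rank1Residual.X2.ClassClosureOfFacts
import HarnessLib

/-!
# The X2 class theorem modulo residues and `BSD(E,p)` per GV-parity pair, WITHOUT the period fact
# A180 (cell `b2b-bsdres`, unit `b2b-bsdres-eisenstein-p2`, gen 28)

HONEST FRAMING (run/shared/lean/b2b/bsd-rank1-residual/, verbatim in every file): the goal of the
cell is to DELETE the COMBINATION-SHAPED residual classes of the Birch–Swinnerton-Dyer formula for
ALL analytic-rank `≤ 1` elliptic curves over `ℚ` — "full BSD formula for every rank `≤ 1` curve in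
class `C`" assembled STRICTLY from published theorems — so that the rank-`≤ 1` remainder becomes
exactly the CONSTRUCTION-SHAPED classes, which are TYPED (missing-input `Prop`s), NOT attempted.
This is not "finishing BSD". Research route; NO CLAIM BEYOND STATED CLASSES; nothing here changes
a label. Theorems only; no definition, no named fact.

WHAT. Gen 27's `ClassClosureOfDerivedTrivialZero.target_of_derivedTrivialZero_of_residues` and
`bsdp_of_classX2_of_gvPar_of_derivedTrivialZero` re-threaded with the Greenberg–Vatsal multiplicative
clause A63 taken from gen 28's PERIOD-FREE derivation
(`GreenbergVatsalCaseTwoPeriodFree.lambdaMu_multiplicative_of_gvPar_periodFree`: ten registered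
facts, A180 discharged by `X2/IsogenyPeriodRatio`). Bodies = gen 19's `ClassClosureOfFacts` bodies
verbatim after the first `have`. Residues unchanged (X2b: Mazur's MC at the pair; X2c: the pair's
Schneider certificate, plus `O9.ExceptionalLeadingTermAt` at split `p`).

References: [GreenbergVatsal2000] Thm. (1.3), §2 p. 28, §3 Thm. (3.11); [Wuthrich2014] Thm. 16;
[SteinWuthrich2013] Thm. 6.1, §4.2; [Disegni2020] Thm. 4; HOME/b2b-bsdres-eisenstein-p2/X2-GAP.md §33.
-/

set_option autoImplicit false

noncomputable section

open scoped Classical AddSubgroup MatrixGroups ModularForm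

open PowerSeries NumberField IsDedekindDomain Field WeierstrassCurve CongruenceSubgroup
  Literature.NumberTheory.EllipticCurves Literature.NumberTheory.EllipticCurves.GreenbergVatsal2000
  Literature.NumberTheory.EllipticCurves.ModularForms
  Literature.NumberTheory.EllipticCurves.Rank1Residual
  Literature.NumberTheory.EllipticCurves.Rank1Residual.Typed
  Literature.NumberTheory.EllipticCurves.Greenberg1999
  Literature.NumberTheory.EllipticCurves.Wuthrich2014
  Literature.NumberTheory.EllipticCurves.SteinWuthrich2013
  Literature.NumberTheory.EllipticCurves.Disegni2020
  Summit.BirchSwinnertonDyer.Rank1Residual.X2.GreenbergVatsalInputsOfFacts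
  Summit.BirchSwinnertonDyer.Rank1Residual.X2.GreenbergVatsalCaseTwoPeriodFree

namespace Summit.BirchSwinnertonDyer.Rank1Residual.X2.ClassClosurePeriodFree

/-- **THE CLASS THEOREM OF RECORD MODULO NAMED RESIDUES, period-free** — gen 19's
`target_of_facts_of_residues` with the class-level registered inputs of gen 28: T-GV23L `h23`,
A137′ `hInf`, A40/A41 `hT`/`hT'`, A135 `hB`, A195 `hLiftF`, A226 `h311`, A224/A225 `hC`/`hD`, A33
`hWu` (A133, A137, A61, A196, F0, A180 all derived), + the rank-`≤ 1` assembly facts; per-pair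
residues exactly as in gen 19 (`hResB`, `hResCns`, `hResCs`).
[cite: GreenbergVatsal2000, Thm. (1.3), §1 pp. 14–15, §2 pp. 28–30, §3 Thm. (3.11), (26)–(28), pp. 41–43]
[cite: Wuthrich2014, Thm. 16 (p. 397)] [cite: Disegni2020, Thm. 4 (§3.2)]
[cite: SteinWuthrich2013, Thm. 6.1 (p. 20) and §4.2] -/
theorem target_periodFree_of_residues
    (h23 : datumSelmer_nonPrimitive_invariants)
    (hInf : datumStrictSelmer_relIndex_eq_zero_of_split)
    (hT : Silverman1994_thmV53_tateUniformisation.{0})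
    (hT' : Silverman1994_thmV53_corV54_tateUniformisation.{0})
    (hB : datumSelmer_divisible_of_finite_torsionBy)
    (hLiftF : residualEpsilon_surjOn_of_lineRamifiedEven)
    (h311 : thm311_hasUnitContent_iff_and_order_eq_of_lineRamifiedEven)
    (hC : characterLFunctionC_hasUnitContent_and_order_eq_card)
    (hD : characterLFunctionD_hasUnitContent_and_order_eq_card)
    (hWu : thm16_charIdeal_dvd_multiplicative_of_reducible)
    (hJs : thm61_splitMultiplicative) (hJn : thm61_nonsplitMultiplicative)
    (hHs : exists_isSplitMultCanonical) (hHn : exists_isMultCanonical)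
    (hGZ : GrossZagier1986_thm_I_7_3) (hGZK : rank_eq_analyticRank_of_analyticRank_le_one)
    (hmod : hasEntireLFunction_rat) (hpar : nonempty_modularParametrizationData)
    (hGS : ∀ (W : WeierstrassCurve ℚ) [W.IsElliptic] [W.IsGloballyMinimal] (p : ℕ) [Fact p.Prime],
      greenberg_stevens (W := W) (p := p))
    (hDis : padicBSD_rankOne_nonsplitMult)
    (hResB : ∀ (W : WeierstrassCurve ℚ) [W.IsElliptic] [W.IsGloballyMinimal] (p : ℕ) [Fact p.Prime],
      CellB W p → MazurMainConjectureAt W p)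
    (hResCns : ∀ (W : WeierstrassCurve ℚ) [W.IsElliptic] [W.IsGloballyMinimal] (p : ℕ) [Fact p.Prime],
      CellC W p → ¬ W.HasSplitMultiplicativeReductionAtPrime p →
        (GVPar W p ∨ MazurMainConjectureAt W p) ∧
        ∀ (q : ℚ_[p]) (Dh : PAdicHeightData W p), q ≠ 0 → ‖q‖ < 1 → tateJ q = (W.j : ℚ_[p]) →
          IsMultCanonical Dh q → SchneiderConjecture Dh)
    (hResCs : ∀ (W : WeierstrassCurve ℚ) [W.IsElliptic] [W.IsGloballyMinimal] (p : ℕ) [Fact p.Prime],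
      CellC W p → W.HasSplitMultiplicativeReductionAtPrime p →
        (GVPar W p ∨ MazurMainConjectureAt W p) ∧ O9.ExceptionalLeadingTermAt W p ∧
        ∀ (Dq : TateParameterData W p) (Dh : PAdicHeightData W p),
          IsSplitMultCanonical Dh Dq → SchneiderConjecture Dh) :
    Target := by
  have hGV : lambdaMu_multiplicative_of_gvPar :=
    lambdaMu_multiplicative_of_gvPar_periodFree h23 hInf hT hT' hB hLiftF h311 hC hD hWu
  refine target_of_targets (targetA_of_published hGV hWu hJs hJn hHs hHn hGZK hmod hpar hGS)
    (targetB_of_missingInputB hJs hJn hHs hHn hGZK hmod hpar hGS hResB) ?_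
  intro W _ _ p _ hc
  by_cases hsplit : W.HasSplitMultiplicativeReductionAtPrime p
  · obtain ⟨hMC, hExc, hSch⟩ := hResCs W p hc hsplit
    have hMC' : MazurMainConjectureAt W p := by
      rcases hMC with hgv | hMC
      · exact mazurMainConjectureAt_of_gvPar hGV hWu W p hc.2.1 hc.2.2.2 hgv
      · exact hMC
    exact bsdp_of_cellC_of_split_of_mazurMainConjectureAt_of_exceptionalLeadingTerm W p hJs hHs hGZ
      hGZK hpar hc hsplit hMC' hExc hSch
  · obtain ⟨hMC, hSch⟩ := hResCns W p hc hsplit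
    exact bsdp_of_cellC_of_not_split_of_gvPar_or_mazurMainConjectureAt_of_schneider W p hDis hGV hWu
      hJn hHn hGZ hGZK hpar hc hsplit hMC hSch


/-- **X2 WITHOUT residues on its GV-parity part, period-free**: on every X2 pair with `GVPar`,
`BSD(E,p)` holds at `r_an = 0` outright and at `r_an = 1` modulo the Schneider certificate
(non-split) / the certificate and the typed exceptional leading term (split) — gen 19's
`bsdp_of_classX2_of_gvPar_of_facts` with the gen-28 registered inputs (no A180).
[cite: GreenbergVatsal2000, Thm. (1.3) with §2 pp. 28–30, §3 Thm. (3.11)]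
[cite: Disegni2020, Thm. 4 (§3.2)] [cite: Wuthrich2014, Thm. 16 (p. 397)] -/
theorem bsdp_of_classX2_of_gvPar_periodFree
    (h23 : datumSelmer_nonPrimitive_invariants)
    (hInf : datumStrictSelmer_relIndex_eq_zero_of_split)
    (hT : Silverman1994_thmV53_tateUniformisation.{0})
    (hT' : Silverman1994_thmV53_corV54_tateUniformisation.{0})
    (hB : datumSelmer_divisible_of_finite_torsionBy)
    (hLiftF : residualEpsilon_surjOn_of_lineRamifiedEven)
    (h311 : thm311_hasUnitContent_iff_and_order_eq_of_lineRamifiedEven)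
    (hC : characterLFunctionC_hasUnitContent_and_order_eq_card)
    (hD : characterLFunctionD_hasUnitContent_and_order_eq_card)
    (hWu : thm16_charIdeal_dvd_multiplicative_of_reducible)
    (hJs : thm61_splitMultiplicative) (hJn : thm61_nonsplitMultiplicative)
    (hHs : exists_isSplitMultCanonical) (hHn : exists_isMultCanonical)
    (hGZ : GrossZagier1986_thm_I_7_3) (hGZK : rank_eq_analyticRank_of_analyticRank_le_one)
    (hmod : hasEntireLFunction_rat) (hpar : nonempty_modularParametrizationData)
    (W : WeierstrassCurve ℚ) [W.IsElliptic] [W.IsGloballyMinimal] (p : ℕ) [Fact p.Prime]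
    (hGS : greenberg_stevens (W := W) (p := p)) (hDis : padicBSD_rankOne_nonsplitMult)
    (hr : W.analyticRank ≤ 1) (hX : ClassX2 W p) (hgv : GVPar W p)
    (hSchNs : W.analyticRank = 1 → ¬ W.HasSplitMultiplicativeReductionAtPrime p →
      ∀ (q : ℚ_[p]) (Dh : PAdicHeightData W p), q ≠ 0 → ‖q‖ < 1 → tateJ q = (W.j : ℚ_[p]) →
        IsMultCanonical Dh q → SchneiderConjecture Dh)
    (hExcS : W.analyticRank = 1 → W.HasSplitMultiplicativeReductionAtPrime p →
      O9.ExceptionalLeadingTermAt W p ∧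
      ∀ (Dq : TateParameterData W p) (Dh : PAdicHeightData W p),
        IsSplitMultCanonical Dh Dq → SchneiderConjecture Dh) :
    BSDp W p := by
  have hGV : lambdaMu_multiplicative_of_gvPar :=
    lambdaMu_multiplicative_of_gvPar_periodFree h23 hInf hT hT' hB hLiftF h311 hC hD hWu
  rcases Nat.le_one_iff_eq_zero_or_eq_one.mp hr with h0 | h1
  · exact bsdp_of_classX2_of_gvPar_of_analyticRank_eq_zero hGV hWu hJs hJn hHs hHn hGZK hmod hpar W p
      hGS h0 hX hgv
  · have hc : CellC W p := ⟨h1, hX⟩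
    by_cases hsplit : W.HasSplitMultiplicativeReductionAtPrime p
    · obtain ⟨hExc, hSch⟩ := hExcS h1 hsplit
      exact bsdp_of_cellC_of_split_of_gvPar_of_exceptionalLeadingTerm W p hGV hWu hJs hHs hGZ hGZK hpar
        ⟨hc, hsplit, hgv⟩ hExc hSch
    · exact bsdp_of_cellC_of_not_split_of_gvPar_of_schneider W p hDis hGV hWu hJn hHn hGZ hGZK hpar
        ⟨hc, hsplit, hgv⟩ (hSchNs h1 hsplit)

end Summit.BirchSwinnertonDyer.Rank1Residual.X2.ClassClosurePeriodFree

end
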